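import Summits.ABC.ABC.Theses.FeketeScales

/-!
# The dyadic hereditary factorisation `D_{2d} = D_d ⊗ S_d` — stub `dyadic_hereditary_factorisation` of crux stmt-ABC-2160 (line SketchIdeator3)

For coprime `0 < y < x` and `d ≥ 1` the difference triple
`D_{2d} = (y^{2d}, x^{2d} - y^{2d}, x^{2d})` factors into the abc triples
`D_d = (y^d, x^d - y^d, x^d)` and `S_d = (y^d, x^d, x^d + y^d)`:
`x^{2d} ≤ x^d (x^d + y^d)` and `rad(D_d) · rad(S_d) ∣ 2 · rad(xy) · rad(D_{2d})`.
Proof: with `X = x^d`, `Y = y^d`, `u = X - Y`, `v = X + Y` one has `X² - Y² = v u`,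
`gcd(u, v) ∣ gcd(2X, 2Y) = 2`, and the elementary identity
`rad m · rad n = rad(m n) · rad(gcd(m, n))` (prime factor sets: union and intersection), applied to
`m = X Y u`, `n = X Y v`, whose gcd is `X Y · gcd(u, v)`; finally `rad(X Y) = rad(x y)`.
Source: idea card core-lattice-dichotomy (crux workfiles), First lemma.  Mathlib only.
-/

-- `Summit.<Summit>.<Problem>` is the mandated summit-side namespace (CONVENTIONS §2); for the
-- single-conjunct summit `ABC` the two coincide, so the duplicate `ABC.ABC` is deliberate.
set_option linter.dupNamespace false

namespace Summit.ABC.ABC.Theorems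

open Literature.NumberTheory.DiophantineGeometry UniqueFactorizationMonoid

/-- `rad m · rad n = rad(m n) · rad(gcd(m, n))` in `ℕ`: the prime factor set of `m n` is the union
and that of `gcd(m, n)` the intersection of the prime factor sets of `m` and `n`. [folklore] -/
theorem ScaleSubmultiplicativity.Dyadic.radical_mul_radical (m n : ℕ) :
    radical m * radical n = radical (m * n) * radical (Nat.gcd m n) := by
  rcases eq_or_ne m 0 with rfl | hm
  · simp
  rcases eq_or_ne n 0 with rfl | hn
  · simp
  simp only [Nat.radical_eq_prod_primeFactors]
  rw [Nat.primeFactors_mul hm hn, Nat.primeFactors_gcd hm hn, Finset.prod_union_inter]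

/-- For coprime `Y ≤ X` one has `gcd(X - Y, X + Y) ∣ 2` (it divides the sum `2X` and the
difference `2Y`). [folklore] -/
theorem ScaleSubmultiplicativity.Dyadic.gcd_sub_add_dvd_two {X Y : ℕ} (hYX : Y ≤ X)
    (h : Nat.Coprime X Y) : Nat.gcd (X - Y) (X + Y) ∣ 2 := by
  have h1 : Nat.gcd (X - Y) (X + Y) ∣ X - Y := Nat.gcd_dvd_left _ _
  have h2 : Nat.gcd (X - Y) (X + Y) ∣ X + Y := Nat.gcd_dvd_right _ _
  have h3 : Nat.gcd (X - Y) (X + Y) ∣ 2 * X := by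
    have e : X - Y + (X + Y) = 2 * X := by omega
    simpa only [e] using dvd_add h1 h2
  have h4 : Nat.gcd (X - Y) (X + Y) ∣ 2 * Y := by
    have e : X + Y - (X - Y) = 2 * Y := by omega
    simpa only [e] using Nat.dvd_sub h2 h1
  have h5 : Nat.gcd (X - Y) (X + Y) ∣ Nat.gcd (2 * X) (2 * Y) := Nat.dvd_gcd h3 h4
  rwa [Nat.gcd_mul_left, h.gcd_eq_one, mul_one] at h5

/-- For coprime `0 < Y < X` the difference triple `(Y, X - Y, X)` is an abc triple. [folklore] -/
theorem ScaleSubmultiplicativity.Dyadic.isABCTriple_sub {X Y : ℕ} (hY : 0 < Y) (hYX : Y < X)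
    (h : Nat.Coprime X Y) : IsABCTriple Y (X - Y) X :=
  ⟨hY, Nat.sub_pos_of_lt hYX, by omega, (Nat.coprime_sub_self_right hYX.le).mpr h.symm⟩

/-- For coprime positive `X, Y` the sum triple `(Y, X, X + Y)` is an abc triple. [folklore] -/
theorem ScaleSubmultiplicativity.Dyadic.isABCTriple_add {X Y : ℕ} (hY : 0 < Y) (hX : 0 < X)
    (h : Nat.Coprime X Y) : IsABCTriple Y X (X + Y) :=
  ⟨hY, hX, Nat.add_comm Y X, h.symm⟩

/-- The factorisation at squares: for coprime `0 < Y < X`, with `u = X - Y` and `v = X + Y`, the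
triples `(Y², X² - Y², X²)`, `(Y, u, X)`, `(Y, X, v)` are abc triples, `X² ≤ X (X + Y)`, and
`rad(Y, u, X) · rad(Y, X, v) ∣ 2 · rad(X Y) · rad(Y², X² - Y², X²)`. [folklore] -/
theorem ScaleSubmultiplicativity.Dyadic.core {X Y : ℕ} (hY : 0 < Y) (hYX : Y < X)
    (h : Nat.Coprime X Y) :
    IsABCTriple (Y ^ 2) (X ^ 2 - Y ^ 2) (X ^ 2) ∧ IsABCTriple Y (X - Y) X ∧
      IsABCTriple Y X (X + Y) ∧ X ^ 2 ≤ X * (X + Y) ∧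
      rad Y (X - Y) X * rad Y X (X + Y) ∣
        2 * radical (X * Y) * rad (Y ^ 2) (X ^ 2 - Y ^ 2) (X ^ 2) := by
  have hX : 0 < X := lt_trans hY hYX
  refine ⟨Dyadic.isABCTriple_sub (pow_pos hY 2) (Nat.pow_lt_pow_left hYX two_ne_zero) (h.pow 2 2),
    Dyadic.isABCTriple_sub hY hYX h, Dyadic.isABCTriple_add hY hX h, ?_, ?_⟩
  · rw [sq, mul_add]
    exact Nat.le_add_right _ _
  · have e1 : Y * (X - Y) * X = X * Y * (X - Y) := by ring
    have e2 : Y * X * (X + Y) = X * Y * (X + Y) := by ring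
    have e3 : Y ^ 2 * (X ^ 2 - Y ^ 2) * X ^ 2 = X * Y * (X - Y) * (X * Y * (X + Y)) := by
      rw [Nat.sq_sub_sq]
      ring
    rw [rad_def, rad_def, rad_def, e1, e2, e3, Dyadic.radical_mul_radical, Nat.gcd_mul_left]
    have hg : radical (X * Y * Nat.gcd (X - Y) (X + Y)) ∣ radical (X * Y) * 2 :=
      radical_mul_dvd.trans
        (mul_dvd_mul_left _ (radical_dvd_self.trans (Dyadic.gcd_sub_add_dvd_two hYX.le h)))
    calc radical (X * Y * (X - Y) * (X * Y * (X + Y))) * radical (X * Y * Nat.gcd (X - Y) (X + Y))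
        ∣ radical (X * Y * (X - Y) * (X * Y * (X + Y))) * (radical (X * Y) * 2) :=
          mul_dvd_mul_left _ hg
      _ = 2 * radical (X * Y) * radical (X * Y * (X - Y) * (X * Y * (X + Y))) := by ring

/-- **Stub S2 of crux stmt-ABC-2160** (`DyadicHereditaryFactorisation`, card core-lattice-dichotomy,
First lemma).  For coprime `0 < y < x` and `d ≥ 1` the difference triple
`D_{2d} = (y^{2d}, x^{2d} - y^{2d}, x^{2d})` factors into the abc triples
`D_d = (y^d, x^d - y^d, x^d)` and `S_d = (y^d, x^d, x^d + y^d)`: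
all three are abc triples, `c(D_{2d}) = x^{2d} ≤ x^d (x^d + y^d) = c(D_d) · c(S_d)`, and
`rad(D_d) · rad(S_d) ∣ 2 · rad(xy) · rad(D_{2d})` (since `x^{2d} - y^{2d} = (x^d - y^d)(x^d + y^d)`
with `gcd ∣ 2`, and `rad m · rad n = rad(m n) · rad(gcd(m, n))`). [folklore] -/
theorem ScaleSubmultiplicativity.dyadic_hereditary_factorisation :
    ∀ x y d : ℕ, 0 < y → y < x → Nat.Coprime x y → 0 < d →
      IsABCTriple (y ^ (2 * d)) (x ^ (2 * d) - y ^ (2 * d)) (x ^ (2 * d)) ∧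
      IsABCTriple (y ^ d) (x ^ d - y ^ d) (x ^ d) ∧ IsABCTriple (y ^ d) (x ^ d) (x ^ d + y ^ d) ∧
      x ^ (2 * d) ≤ x ^ d * (x ^ d + y ^ d) ∧
      rad (y ^ d) (x ^ d - y ^ d) (x ^ d) * rad (y ^ d) (x ^ d) (x ^ d + y ^ d) ∣
        2 * UniqueFactorizationMonoid.radical (x * y) *
          rad (y ^ (2 * d)) (x ^ (2 * d) - y ^ (2 * d)) (x ^ (2 * d)) := by
  intro x y d hy hyx hcop hd
  have hX : x ^ (2 * d) = (x ^ d) ^ 2 := pow_mul' x 2 d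
  have hY : y ^ (2 * d) = (y ^ d) ^ 2 := pow_mul' y 2 d
  have hr : radical (x * y) = radical (x ^ d * y ^ d) := by
    rw [← mul_pow, radical_pow _ hd.ne']
  rw [hX, hY, hr]
  exact Dyadic.core (pow_pos hy d) (Nat.pow_lt_pow_left hyx hd.ne') (hcop.pow d d)

end Summit.ABC.ABC.Theorems
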